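import Literature.NumberTheory.Sieve.ChenSieveProduct
import HarnessLib

/-!
# Chen's Theorem I: Mertens' estimate for `V(z)` at Chen's level `z = x^{1/10}`

Companion of `ChenTheoremIAssembly.lean` (the assembly of Chen's Theorem I,
`P_x(1,2) ≥ 0.67 x C_x/(log x)²`, Sci. Sinica 16 (1973), from three sieve estimates at the sieving
level `z = x^{1/10}` and the Mertens input (V)). This file PROVES hypothesis (V) of
`Literature.NumberTheory.Sieve.Chen.Chen1973_theoremI_of`:

* `sieveProduct_tenth_estimate` — for all even `N` with `log N ≥ 500` and `z = N^{1/10}`,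
  `|V(z) − 2 𝔖(N) e^{−γ}/log z| ≤ 1170 · (2 𝔖(N) e^{−γ}/log z)/log N`
  (`V(z) = ∏_{p < z, p ∤ N} (1 − 1/(p−1))`, `2 𝔖(N) e^{−γ}/log z = 20 e^{−γ} 𝔖(N)/log N`);
* `sieveProduct_tenth_lower` — the weak form (V): for every `ε > 0` and all large even `x`,
  `V(x^{1/10}) ≥ (1 − ε) · 20 e^{−γ} 𝔖(x)/log x`.

This is Nathanson's Theorem 10.3 (corrected by the factor `2`, see `ChenTheorem`) with `N^{1/8}`
replaced by `N^{1/10}`; Chen uses it in the form (29) (PDF p. 167 of the held copy: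
`Γ_x(x^{1/10}) = (x/φ(x)) ∏_{p ∤ x} (1 − 1/(p−1))/(1 − 1/p) · e^{−γ}/log x^{1/10} · (1 + O(1/log x))`).
The proof is that of `chen_sieveProduct_estimate_holds` (`ChenSieveProduct.lean`), whose lemmas
are stated for a general real cut-off `z` (`sieveProduct_eq_mul`, `abs_mertensFactor_sub_one_le`,
`singularSeries_eq_mul`, `abs_sub_le_of_relErrors`); the only change is that `N ≤ z^{10}` now has at
most `10` prime factors `p ≥ z` (`card_le_ten_of_prod_dvd`), and the factor
`R = ∏_{p ∣ N, p ≥ z, p > 2} (p−1)/(p−2) ≤ (1 + 1/(z−2))^{10}` is still `≤ 1 + 16/log z` because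
`z − 2 ≥ (log z)²/2`.

## References

* Chen Jing-run, Sci. Sinica 16 (1973) 157–176, (29) (PDF p. 167 of the held copy). [ChenSciSinica1973]
* M. B. Nathanson, *Additive Number Theory: The Classical Bases*, GTM 164 (1996), Thm 10.3 and its
  proof, pp. 170–171 of the held copy. [Nathanson1996]
-/

noncomputable section

open Finset Filter

namespace Literature.NumberTheory.Sieve.Chen

/-- If `S` is a set of prime factors of `N ≠ 0`, all `≥ z > 1`, and `N ≤ z^{10}`, then `#S ≤ 10`
(`z^{#S} ≤ ∏_{p ∈ S} p ≤ N ≤ z^{10}`). [folklore] -/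
theorem card_le_ten_of_prod_dvd {N : ℕ} {z : ℝ} (hN0 : N ≠ 0) (hz1 : 1 < z)
    (hNz : (N : ℝ) ≤ z ^ 10) {S : Finset ℕ} (hS : S ⊆ N.primeFactors) (hSz : ∀ p ∈ S, z ≤ p) :
    S.card ≤ 10 := by
  have hdvd : (∏ p ∈ S, p) ∣ N :=
    (Finset.prod_dvd_prod_of_subset S N.primeFactors (fun p => p) hS).trans
      (Nat.prod_primeFactors_dvd N)
  have hle : (∏ p ∈ S, p) ≤ N := Nat.le_of_dvd (Nat.pos_of_ne_zero hN0) hdvd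
  have h : z ^ S.card ≤ z ^ 10 := by
    calc z ^ S.card = ∏ _p ∈ S, z := (Finset.prod_const z).symm
      _ ≤ ∏ p ∈ S, (p : ℝ) := Finset.prod_le_prod (fun _ _ => by linarith) hSz
      _ = ((∏ p ∈ S, p : ℕ) : ℝ) := (Nat.cast_prod _ _).symm
      _ ≤ N := by exact_mod_cast hle
      _ ≤ z ^ 10 := hNz
  exact (pow_le_pow_iff_right₀ hz1).mp h

/-- The factor `R = ∏_{p ∣ N, p ≥ z, p > 2} (p−1)/(p−2)` satisfies `1 ≤ R ≤ (1 + 1/(z−2))^{10}` when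
`N ≠ 0`, `z > 2` and `N ≤ z^{10}`. [cite: Nathanson1996, Thm 10.3 (proof)] -/
theorem one_le_largeFactor_and_le_ten {N : ℕ} {z : ℝ} (hN0 : N ≠ 0) (hz : 2 < z)
    (hNz : (N : ℝ) ≤ z ^ 10) :
    1 ≤ ∏ p ∈ (N.primeFactors.filter (2 < ·)).filter (fun p : ℕ => ¬p < ⌈z⌉₊),
        ((p : ℝ) - 1) / ((p : ℝ) - 2) ∧
      ∏ p ∈ (N.primeFactors.filter (2 < ·)).filter (fun p : ℕ => ¬p < ⌈z⌉₊),
        ((p : ℝ) - 1) / ((p : ℝ) - 2) ≤ (1 + 1 / (z - 2)) ^ 10 := by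
  set S := (N.primeFactors.filter (2 < ·)).filter (fun p : ℕ => ¬p < ⌈z⌉₊) with hSdef
  have hSz : ∀ p ∈ S, z ≤ p := fun p hp => by
    have h : ⌈z⌉₊ ≤ p := not_lt.mp (Finset.mem_filter.mp hp).2
    exact (Nat.le_ceil z).trans (by exact_mod_cast h)
  have hS2 : ∀ p ∈ S, 2 < p := fun p hp => (Finset.mem_filter.mp (Finset.mem_filter.mp hp).1).2
  have hS : S ⊆ N.primeFactors := fun p hp => (Finset.mem_filter.mp (Finset.mem_filter.mp hp).1).1
  have hcard : S.card ≤ 10 := card_le_ten_of_prod_dvd hN0 (by linarith) hNz hS hSz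
  refine ⟨Finset.one_le_prod fun p hp => one_le_singularSeriesFactor (hS2 p hp), ?_⟩
  have hfac : ∀ p ∈ S, ((p : ℝ) - 1) / ((p : ℝ) - 2) ≤ 1 + 1 / (z - 2) := fun p hp => by
    have hzp := hSz p hp
    have hp2 : (0 : ℝ) < (p : ℝ) - 2 := by linarith
    have e : ((p : ℝ) - 1) / ((p : ℝ) - 2) = 1 + 1 / ((p : ℝ) - 2) := by
      field_simp
      ring
    rw [e]
    gcongr 1 + ?_
    exact one_div_le_one_div_of_le (by linarith) (by linarith)
  calc ∏ p ∈ S, ((p : ℝ) - 1) / ((p : ℝ) - 2) ≤ ∏ _p ∈ S, (1 + 1 / (z - 2)) :=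
        Finset.prod_le_prod (fun p hp => zero_le_one.trans (one_le_singularSeriesFactor (hS2 p hp)))
          hfac
    _ = (1 + 1 / (z - 2)) ^ S.card := Finset.prod_const _
    _ ≤ (1 + 1 / (z - 2)) ^ 10 := by
        refine pow_le_pow_right₀ ?_ hcard
        have : 0 ≤ 1 / (z - 2) := by
          have : 0 < z - 2 := by linarith
          positivity
        linarith

/-- `(1 + t)^{10} − 1 ≤ 20t` for `0 ≤ t ≤ 1/1000` (via `(1 + t)^{10} ≤ e^{10t}` and
`|e^u − 1| ≤ 2|u|` for `|u| ≤ 1`). [folklore] -/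
theorem pow_ten_sub_one_le {t : ℝ} (ht0 : 0 ≤ t) (ht : t ≤ 1 / 1000) :
    (1 + t) ^ 10 - 1 ≤ 20 * t := by
  have ht10 : |10 * t| ≤ 1 := by
    rw [abs_of_nonneg (by positivity)]
    linarith
  have hexp : (1 + t) ^ 10 ≤ Real.exp (10 * t) := by
    have h1 : 1 + t ≤ Real.exp t := by linarith [Real.add_one_le_exp t]
    calc (1 + t) ^ 10 ≤ Real.exp t ^ 10 := pow_le_pow_left₀ (by linarith) h1 10
      _ = Real.exp (10 * t) := by rw [← Real.exp_nat_mul]; norm_num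
  have hexp1 : Real.exp (10 * t) - 1 ≤ 20 * t := by
    have h := Real.abs_exp_sub_one_le ht10
    rw [abs_of_nonneg (by positivity : (0 : ℝ) ≤ 10 * t)] at h
    linarith [le_abs_self (Real.exp (10 * t) - 1)]
  linarith

/-- **Mertens' estimate for `V(z)` at `z = N^{1/10}`** (Nathanson Thm 10.3, corrected by the
factor `2`, at Chen's level; Chen 1973, (29)): for all even `N` with `log N ≥ 500`,
`|V(N^{1/10}) − 2 𝔖(N) e^{−γ}/log N^{1/10}| ≤ 1170 · (2 𝔖(N) e^{−γ}/log N^{1/10})/log N`.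
Inputs: Mertens' product theorem with rate (`abs_mertensFactor_sub_one_le`), the tail of `C₂`
(`twinPrimeConstPartial_mul_le_twinPrimeConst`), and `#{p ∣ N : p ≥ N^{1/10}} ≤ 10`.
[cite: Nathanson1996, Thm 10.3] -/
theorem sieveProduct_tenth_estimate {N : ℕ} (hlogN : 500 ≤ Real.log N) (hEven : Even N) :
    |sieveProduct N ((N : ℝ) ^ (1 / 10 : ℝ)) -
        2 * singularSeries N * Real.exp (-Real.eulerMascheroniConstant) /
          Real.log ((N : ℝ) ^ (1 / 10 : ℝ))| ≤
      1170 * (2 * singularSeries N * Real.exp (-Real.eulerMascheroniConstant) /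
          Real.log ((N : ℝ) ^ (1 / 10 : ℝ))) / Real.log N := by
  have hNpos : (0 : ℝ) < N := by
    by_contra h
    have h0 : (N : ℝ) = 0 := le_antisymm (not_lt.mp h) N.cast_nonneg
    rw [h0, Real.log_zero] at hlogN
    linarith
  have hN0 : N ≠ 0 := by exact_mod_cast hNpos.ne'
  -- the parameter `z = N^{1/10}` and `L = log z = (log N)/10`
  set z := (N : ℝ) ^ (1 / 10 : ℝ) with hzdef
  set L := Real.log z with hLdef
  have hLN : L = Real.log N / 10 := by rw [hLdef, hzdef, Real.log_rpow hNpos]; ring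
  have hL50 : 50 ≤ L := by rw [hLN]; linarith
  have hL0 : 0 < L := by linarith
  have hzpos : 0 < z := Real.rpow_pos_of_pos hNpos _
  have hquad : 1 + L + L ^ 2 / 2 ≤ z := by
    rw [← Real.exp_log hzpos]
    exact Real.quadratic_le_exp_of_nonneg hL0.le
  have hzL1 : L + 1 ≤ z := by nlinarith [sq_nonneg L]
  have hzL : L ^ 2 / 2 ≤ z - 2 := by nlinarith
  have hz2 : 2 < z := by linarith
  have hz10 : (N : ℝ) ≤ z ^ 10 := by
    rw [hzdef, ← Real.rpow_natCast, ← Real.rpow_mul hNpos.le]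
    norm_num
  -- the pieces
  set Z := ⌈z⌉₊ with hZ
  set U := ∏ p ∈ Nat.primesBelow Z, (1 - (p : ℝ)⁻¹) with hU
  set T := ∏ p ∈ (Nat.primesBelow Z).filter (2 < ·), (1 - 1 / ((p : ℝ) - 1) ^ 2) with hT
  set Qz := ∏ p ∈ (N.primeFactors.filter (2 < ·)).filter (· < Z),
    ((p : ℝ) - 1) / ((p : ℝ) - 2) with hQz
  set R := ∏ p ∈ (N.primeFactors.filter (2 < ·)).filter (fun p : ℕ => ¬p < Z),
    ((p : ℝ) - 1) / ((p : ℝ) - 2) with hR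
  have hV : sieveProduct N z = 2 * U * T * Qz := sieveProduct_eq_mul hEven hN0 hz2
  have hS : singularSeries N = twinPrimeConst * (Qz * R) := singularSeries_eq_mul N Z
  -- `α = U e^γ L`
  have hα : |U * (Real.exp Real.eulerMascheroniConstant * L) - 1| ≤ 50 / L :=
    abs_mertensFactor_sub_one_le hz2.le (by linarith)
  -- `β = T/C₂`
  have hC2 : 0 < twinPrimeConst := twinPrimeConst_pos_holds
  have hZz : z ≤ Z := Nat.le_ceil _
  have h3Z : 3 ≤ Z := by
    have : (3 : ℝ) ≤ Z := by linarith
    exact_mod_cast this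
  have hTdef : T = twinPrimeConstPartial (Z - 1) := by
    rw [hT, twinPrimeConstPartial, Nat.primesBelow_eq_primesLE_sub_one]
  have hC2T : twinPrimeConst ≤ T := hTdef ▸ twinPrimeConst_le_twinPrimeConstPartial _
  have hx : (((Z - 1 : ℕ) : ℝ)) = (Z : ℝ) - 1 := by
    rw [Nat.cast_sub (by omega)]; norm_num
  have hTC2 : T * (((Z : ℝ) - 1 - 1) / ((Z : ℝ) - 1)) ≤ twinPrimeConst := by
    have h := twinPrimeConstPartial_mul_le_twinPrimeConst (x := Z - 1) (by omega)
    rwa [← hTdef, hx] at h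
  have hβ1 : 1 ≤ T / twinPrimeConst := (one_le_div hC2).mpr hC2T
  have hβ2 : T / twinPrimeConst - 1 ≤ 1 / L := by
    have hZ2 : L ≤ (Z : ℝ) - 2 := by nlinarith
    have hZ2pos : 0 < (Z : ℝ) - 2 := by linarith
    have h1 : T * ((Z : ℝ) - 2) ≤ twinPrimeConst * ((Z : ℝ) - 1) := by
      have h := hTC2
      rw [show (Z : ℝ) - 1 - 1 = (Z : ℝ) - 2 by ring, mul_div_assoc', div_le_iff₀ (by linarith)]
        at h
      exact h
    calc T / twinPrimeConst - 1 = (T - twinPrimeConst) / twinPrimeConst := by field_simp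
      _ ≤ 1 / ((Z : ℝ) - 2) := by
          rw [div_le_div_iff₀ hC2 hZ2pos]
          nlinarith
      _ ≤ 1 / L := one_div_le_one_div_of_le hL0 hZ2
  -- `R ≤ (1 + t)^{10} ≤ 1 + 20t`, `t = 1/(z−2) ≤ 2/L²`, and `40/L² ≤ 16/L`
  have hz2' : 0 < z - 2 := by linarith
  have hL2 : 0 < L ^ 2 / 2 := by positivity
  have htL : 1 / (z - 2) ≤ 2 / L ^ 2 := by
    calc 1 / (z - 2) ≤ 1 / (L ^ 2 / 2) := one_div_le_one_div_of_le hL2 hzL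
      _ = 2 / L ^ 2 := by field_simp
  have hLsq : (2500 : ℝ) ≤ L ^ 2 := by nlinarith
  have ht1000 : 2 / L ^ 2 ≤ 1 / 1000 := by
    rw [div_le_div_iff₀ (by positivity) (by norm_num)]; linarith
  have h40 : 20 * (2 / L ^ 2) ≤ 16 / L := by
    rw [show 20 * (2 / L ^ 2) = 40 / L ^ 2 by ring, div_le_div_iff₀ (by positivity) hL0]
    nlinarith
  have hpow := pow_ten_sub_one_le (by positivity : (0 : ℝ) ≤ 1 / (z - 2)) (htL.trans ht1000)
  obtain ⟨hR1, hRle⟩ := one_le_largeFactor_and_le_ten hN0 hz2 hz10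
  have hR2 : R - 1 ≤ 16 / L :=
    calc R - 1 ≤ (1 + 1 / (z - 2)) ^ 10 - 1 := sub_le_sub_right hRle 1
      _ ≤ 20 * (1 / (z - 2)) := hpow
      _ ≤ 20 * (2 / L ^ 2) := by gcongr
      _ ≤ 16 / L := h40
  -- the identity `V R = M α β`
  set M := 2 * singularSeries N * Real.exp (-Real.eulerMascheroniConstant) / L with hM
  have hMpos : 0 < M := by
    have := singularSeries_pos N
    positivity
  have hVR : sieveProduct N z * R =
      M * (U * (Real.exp Real.eulerMascheroniConstant * L)) * (T / twinPrimeConst) := by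
    rw [hV, hM, hS, Real.exp_neg]
    field_simp
  have hmain := abs_sub_le_of_relErrors hMpos hL50 hVR hα hβ1 hβ2 hR1 hR2
  -- `117 M / L = 1170 M / log N`
  calc |sieveProduct N z - M| ≤ 117 * M / L := hmain
    _ = 1170 * M / Real.log N := by
        rw [show Real.log N = 10 * L by rw [hLN]; ring]
        field_simp
        norm_num

/-- **Hypothesis (V) of `Chen1973_theoremI_of`, PROVED**: for every `ε > 0` and all large even `x`,
`V(x^{1/10}) ≥ (1 − ε) · 20 e^{−γ} 𝔖(x)/log x` (from `sieveProduct_tenth_estimate`: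
`V ≥ M(1 − 1170/log x)`, `M = 2𝔖(x)e^{−γ}/log x^{1/10} = 20 e^{−γ}𝔖(x)/log x`, once
`log x ≥ max(500, 1170/ε)`). [cite: Nathanson1996, Thm 10.3] -/
theorem sieveProduct_tenth_lower {ε : ℝ} (hε : 0 < ε) :
    ∃ x₀ : ℕ, ∀ x : ℕ, x₀ ≤ x → Even x →
      (1 - ε) * (20 * Real.exp (-Real.eulerMascheroniConstant) * singularSeries x / Real.log x) ≤
        sieveProduct x ((x : ℝ) ^ (1 / 10 : ℝ)) := by
  have hlog : Tendsto (fun x : ℕ => Real.log x) atTop atTop :=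
    Real.tendsto_log_atTop.comp (tendsto_natCast_atTop_atTop (R := ℝ))
  obtain ⟨x₀, hx₀⟩ := eventually_atTop.mp
    ((hlog.eventually_ge_atTop 500).and (hlog.eventually_ge_atTop (1170 / ε)))
  refine ⟨x₀, fun x hx hEven => ?_⟩
  obtain ⟨h500, hε'⟩ := hx₀ x hx
  have hxpos : (0 : ℝ) < x := by
    by_contra h
    have h0 : (x : ℝ) = 0 := le_antisymm (not_lt.mp h) x.cast_nonneg
    rw [h0, Real.log_zero] at h500
    linarith
  set Lx := Real.log x with hLx
  have hLx0 : 0 < Lx := by linarith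
  have hlogz : Real.log ((x : ℝ) ^ (1 / 10 : ℝ)) = Lx / 10 := by
    rw [Real.log_rpow hxpos]; ring
  have h := sieveProduct_tenth_estimate h500 hEven
  rw [hlogz] at h
  set M := 2 * singularSeries x * Real.exp (-Real.eulerMascheroniConstant) / (Lx / 10) with hM
  have hMpos : 0 < M := by
    have := singularSeries_pos x
    positivity
  have hM' : 20 * Real.exp (-Real.eulerMascheroniConstant) * singularSeries x / Lx = M := by
    rw [hM]; field_simp; ring
  rw [hM']
  have hlow := (abs_sub_le_iff.mp h).2
  -- `1170 M / Lx ≤ ε M`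
  have hεM : 1170 * M / Lx ≤ ε * M := by
    rw [div_le_iff₀ hLx0]
    have : 1170 ≤ ε * Lx := by
      rw [div_le_iff₀ hε] at hε'
      linarith
    nlinarith
  linarith

end Literature.NumberTheory.Sieve.Chen
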